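import Literature.AlgebraicGeometry.Motives.AlgPointsSeparate
import Mathlib.CategoryTheory.Endomorphism
import HarnessLib

/-!
# Points-determined endomorphisms form an action (`Γ →* Aut X`)

Topic `AlgebraicGeometry/Motives`; namespace `Literature.AlgebraicGeometry.Motives`.  THEOREMS ONLY.  Cell `hodgecm-mathlib`,
T3 (I-1′ / hDel, item 24835) leaf **D2a** of B-p06's `stub_Squot` census (B-plan2 key 14:47:12Z): a family of endomorphisms
`T : Γ → (X ⟶ X)` of a `k`-scheme `X` (reduced, locally of finite type, separated over `k ⊆ Ω`, `Ω` algebraically closed —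
e.g. `Ω = ℂ`) whose action ON `Ω`-POINTS is a (left) action of the group `Γ` (`T 1` fixes every point; `T (g·h)` acts as `T g`
after `T h`) IS a group action by automorphisms: there is `act : Γ →* Aut X` with `(act g).hom = T g`.  Proof: `Ω`-points separate
morphisms into a separated scheme ([MumfordAV1970] §4; tree ★ `SchemeOver.hom_ext_of_forall_algPoints`), so `T 1 = 𝟙` and
`T (g·h) = T h ≫ T g` as MORPHISMS; hence `T g⁻¹` is a two-sided inverse of `T g`, and with Mathlib's convention
`(f * g : Aut X) = g ≪≫ f` (`Aut.Aut_mul_def`: the product acts as `g` first, then `f`) the map `g ↦ ⟨T g, T g⁻¹⟩` is a monoid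
homomorphism.  Used by the T3 quotient step (Hecke translates `Tq` of the integral model act on points by right translation;
`g ↦ Tq(ũ(g⁻¹))` is then a left action to which this applies).
[cite: MumfordAV1970, §4 (morphisms of varieties are determined by their effect on geometric points)]
-/

set_option autoImplicit false

noncomputable section

open CategoryTheory AlgebraicGeometry

universe u v

namespace Literature.AlgebraicGeometry.Motives

section General

variable {k : Type u} [Field k] (Ω : Type u) [Field Ω] [Algebra k Ω] [IsAlgClosed Ω]
variable {X : SchemeOver k} [LocallyOfFiniteType X.hom] [IsReduced X.left] [IsSeparated X.hom]
variable {Γ : Type v} [Group Γ] (T : Γ → (X ⟶ X))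

/-- If `T 1` fixes every `Ω`-point then `T 1 = 𝟙 X` (points separate morphisms). [cite: MumfordAV1970, §4] -/
theorem eq_id_of_forall_algPoints_map_eq (h1 : ∀ P : AlgPoints X Ω, AlgPoints.map (T 1) P = P) : T 1 = 𝟙 X :=
  SchemeOver.hom_ext_of_forall_algPoints Ω fun P => by
    rw [Category.comp_id]
    exact h1 P

/-- If `T (g·h)` acts on `Ω`-points as `T g` after `T h` then `T (g·h) = T h ≫ T g` as morphisms (points separate morphisms;
note the composition order of `≫`). [cite: MumfordAV1970, §4] -/
theorem map_mul_eq_comp_of_forall_algPoints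
    (hmul : ∀ (g h : Γ) (P : AlgPoints X Ω), AlgPoints.map (T (g * h)) P = AlgPoints.map (T g) (AlgPoints.map (T h) P))
    (g h : Γ) : T (g * h) = T h ≫ T g :=
  SchemeOver.hom_ext_of_forall_algPoints Ω fun P => by
    rw [← Category.assoc]
    exact hmul g h P

/-- **Points-determined endomorphisms form an action.**  For a reduced `k`-scheme `X` locally of finite type and separated over
`k`, an algebraically closed `Ω ⊇ k`, a group `Γ` and endomorphisms `T : Γ → (X ⟶ X)` such that ON `Ω`-POINTS `T 1` is the identity
and `T (g·h)` is `T g` after `T h`: there is a homomorphism `act : Γ →* Aut X` with `(act g).hom = T g` for all `g` (Mathlib's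
`Aut X` multiplies by `(f * g) = g ≪≫ f`, i.e. `g` acts first). [cite: MumfordAV1970, §4] -/
theorem exists_monoidHom_aut_of_forall_algPoints (h1 : ∀ P : AlgPoints X Ω, AlgPoints.map (T 1) P = P)
    (hmul : ∀ (g h : Γ) (P : AlgPoints X Ω), AlgPoints.map (T (g * h)) P = AlgPoints.map (T g) (AlgPoints.map (T h) P)) :
    ∃ act : Γ →* Aut X, ∀ g, (act g).hom = T g := by
  have hone : T 1 = 𝟙 X := eq_id_of_forall_algPoints_map_eq Ω T h1
  have hcomp : ∀ g h : Γ, T (g * h) = T h ≫ T g := map_mul_eq_comp_of_forall_algPoints Ω T hmul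
  -- each `T g` is an isomorphism with inverse `T g⁻¹`
  have hinv₁ : ∀ g : Γ, T g ≫ T g⁻¹ = 𝟙 X := fun g => by rw [← hcomp, inv_mul_cancel, hone]
  have hinv₂ : ∀ g : Γ, T g⁻¹ ≫ T g = 𝟙 X := fun g => by rw [← hcomp, mul_inv_cancel, hone]
  let isoOf : Γ → Aut X := fun g => ⟨T g, T g⁻¹, hinv₁ g, hinv₂ g⟩
  refine ⟨{ toFun := isoOf, map_one' := ?_, map_mul' := fun g h => ?_ }, fun g => rfl⟩
  · exact Iso.ext hone
  · apply Iso.ext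
    rw [Aut.Aut_mul_def, Iso.trans_hom]
    exact hcomp g h

end General

section Complex

variable {k : Type} [Field k] [Algebra k ℂ]
variable {X : SchemeOver k} [LocallyOfFiniteType X.hom] [IsReduced X.left] [IsSeparated X.hom]
variable {Γ : Type v} [Group Γ] (T : Γ → (X ⟶ X))

/-- **Points-determined endomorphisms form an action — COMPLEX POINTS** (`Ω = ℂ`, `X(ℂ) = ComplexPoints X`; the shape of B-p06's
census D2a): `∃ act : Γ →* Aut X, ∀ g, (act g).hom = T g`. [cite: MumfordAV1970, §4] -/
theorem exists_monoidHom_aut_of_forall_pts (h1 : ∀ P : ComplexPoints X, AlgPoints.map (T 1) P = P)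
    (hmul : ∀ (g h : Γ) (P : ComplexPoints X), AlgPoints.map (T (g * h)) P = AlgPoints.map (T g) (AlgPoints.map (T h) P)) :
    ∃ act : Γ →* Aut X, ∀ g, (act g).hom = T g :=
  exists_monoidHom_aut_of_forall_algPoints ℂ T h1 hmul

/-- Companion: under the same hypotheses every `T g` is an isomorphism. [cite: MumfordAV1970, §4] -/
theorem isIso_of_forall_pts (h1 : ∀ P : ComplexPoints X, AlgPoints.map (T 1) P = P)
    (hmul : ∀ (g h : Γ) (P : ComplexPoints X), AlgPoints.map (T (g * h)) P = AlgPoints.map (T g) (AlgPoints.map (T h) P))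
    (g : Γ) : IsIso (T g) := by
  obtain ⟨act, hact⟩ := exists_monoidHom_aut_of_forall_pts T h1 hmul
  rw [← hact g]
  infer_instance

end Complex

end Literature.AlgebraicGeometry.Motives

end
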